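import Literature.Analysis.FluidPDE.PassiveVectorTensorDistortedDuality
import Literature.Analysis.FluidPDE.PassiveVectorTensorTransverseKernel
import Literature.Analysis.FluidPDE.PassiveVectorTensorDistortedFrameTest
import Literature.Analysis.FluidPDE.PassiveVectorTensorClass
import HarnessLib

/-!
# Transverse-class invariance of the distorted weak class for HOLONOMIC frames (tool T♮2 of the
# `ad-ideate` canonicalisation device)

Analysis/FluidPDE proof file (everything proved; no definitions, no named facts, no `sorry`) over the
`G`-distorted weak class `Torus.IsWeakTensorPassiveVectorDistortedOn A T 𝔸 b G w₀ w`
(`PassiveVectorTensorDistorted.lean`: `∂ₜw + (b·∇)w + A (w·∇)b + Gᵀ∇π = 𝓛^G w`, `∇·(G w) = 0`, the tensor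
entering ONLY through the divergence-form test operator `viscAdjVar (y ↦ 𝔸^{G(t,y)}) (Ψ t)` against tests
with `∇·(GΨ) = 0`) and the transverse vocabulary of `PassiveVectorTensorTransverseKernel.lean` (T♮0:
`TransverseEq`, the invisible families `Visc4.traceL A = δ_{ia}A_{jb}`, `Visc4.traceR B = B_{ia}δ_{jb}`,
`Visc4.IsDerivAntisymm Z`, and the classification `transverseEq_iff_exists_decomp` at `d = 3`).

THE POINT (the `ad-ideate` canonicalisation device, rulings D28-8‴/D28-10(b)): for a HOLONOMIC frame —
`G(t,·)` smooth with divergence-free columns (Piola) and `G(t)·(1 + ∇φ_t) = 1` for a smooth periodic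
displacement, i.e. `G = (∇X)⁻¹` for the measure-preserving map `X = id + φ_t` (exactly the three fields
`smooth`/`piola`/`holonomic` of the (ℓ3) class of record `IsFrameModulation`) — the distorted weak class
depends on the tensor `𝔸` only through its TRANSVERSE CLASS.  So inside any proof over holonomic frames one
may replace `𝔸` by a transversely equivalent representative (e.g. the full-bounded one of T♮1,
`PassiveVectorTensorTransverseCanonical.lean`).

* §0 algebra: `(traceL A)^M_{icle} = M_{ci}(AMᵀ)_{le}`, `(traceR B)^M_{icle} = (MBᵀ)_{ci}M_{el}`, and
  conjugation preserves `(a,b)`-antisymmetry (`IsDerivAntisymm.conj`).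
* §1 TEST-SIDE PIOLA (`sum_mul_partialDeriv_eq_zero_of_isDivFree_distort`): for Piola columns and
  `∇·(GΨ) = 0`, `Σ_{ic} G_{ci}∂_cΨ_i = 0` pointwise (Leibniz: `∇·(GΨ) = Σ_i Ψ_i ∇·G_{·i} + G:∇Ψ`).
* §2 the three families under the distorted test operator, POINTWISE, any index type:
  (i) `viscAdjVar_conj_traceL_eq_zero`: `𝓛^{(traceL A)^G,*}Ψ ≡ 0` (test-side Piola);
  (ii) `viscAdjVar_conj_traceR_eq`: `𝓛^{(traceR B)^G,*}Ψ = Gᵀ∇φ`, `φ = Σ (GBᵀ)_{ci}∂_cΨ_i` (Piola), hence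
  `∫⟪v, ·⟫ = 0` whenever `∇·(Gv) = 0` weakly (`integral_inner_viscAdjVar_conj_traceR_eq_zero`);
  (iii) `holonomic_torsion_symm`: for `G(1+∇φ) = 1` the torsion vanishes, `Σ_e G_{eb}∂_eG_{ca}` is
  symmetric in `(a,b)` (`∂_eG = −G(∂_eJ)G` and Schwarz for `∇²φ`), whence
  `sum_partialDeriv_conj_eq_zero_of_isDerivAntisymm` (`Σ_e ∂_e (Z^G)_{icje} = 0`) and
  `viscAdjVar_conj_eq_zero_of_isDerivAntisymm`: `𝓛^{Z^G,*}Ψ ≡ 0` for `(a,b)`-antisymmetric `Z`.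
* §3 **T♮2** `IsWeakTensorPassiveVectorDistortedOn.of_add_decomp` (any `d`: `𝔸' = 𝔸 + traceL A + traceR B
  + Z` ⇒ same distorted weak solutions, hypotheses on `G` only for `t ∈ (0,T)`), `….of_transverseEq` and
  `TransverseEq.isWeakTensorPassiveVectorDistortedOn_iff` (`d = 3`, via T♮0).
* §4 the FLAT case `G ≡ 1` (`viscAdjVar_conj_one`, `distort_one`; the identity frame is smooth, Piola and
  holonomic with `φ = 0`): `viscAdj_add_decomp`, `IsWeakTensorPassiveVectorOn.of_add_decomp`,
  `….of_transverseEq`, `TransverseEq.isWeakTensorPassiveVectorOn_iff` — transverse-equal tensors pair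
  equally against (divergence-free test, weakly divergence-free `w`).

For a NON-holonomic frame with Piola columns the antisymmetric family IS visible (the torsion
`[Y_a, Y_b] ≠ 0` enters `Σ_e ∂_e(Z^G)`); (i), (ii) hold for every Piola frame.

References: S. Armstrong, V. Vicol, *Anomalous diffusion by fractal homogenization* (2025), §4.1
[ArmstrongVicol2025]; M. Giaquinta, *Multiple integrals in the calculus of variations and nonlinear
elliptic systems* (1983), Ch. III §2 (2.1)–(2.3) [Giaquinta1983MultipleIntegrals]; L. C. Evans, *Partial
Differential Equations* (2010), §8.1.4.b (null Lagrangians, Piola) [Evans2010]; R. J. DiPerna,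
P.-L. Lions (1989), §II.1 [DiPernaLions1989]; U. Frisch, *Turbulence* (1995), §9.6.3 [Frisch1995Turbulence].
-/

noncomputable section

open MeasureTheory Set Filter Function
open scoped InnerProductSpace

namespace Literature.Analysis.FluidPDE.Torus

variable {d : Type*} [Fintype d] [DecidableEq d]

/-! ## §0 Algebra of the conjugated families -/

section Algebra

/-- The conjugate of a left trace coupling: `(traceL A)^M i c l e = M_{ci} · Σ_b A_{lb} M_{eb}`.
[cite: Giaquinta1983MultipleIntegrals, Ch. III §2 eq. (2.1)-(2.3)] -/
theorem Visc4.conj_traceL_apply (M : Matrix d d ℝ) (A : Matrix d d ℝ) (i c l e : d) :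
    Visc4.conj M (Visc4.traceL A) i c l e = M c i * ∑ b, A l b * M e b := by
  rw [Visc4.conj_apply]
  rw [Finset.sum_eq_single i (fun a _ ha => by simp [Visc4.traceL, Ne.symm ha])
    (fun h => (h (Finset.mem_univ i)).elim)]
  simp only [Visc4.traceL, if_true, Finset.mul_sum]
  exact Finset.sum_congr rfl fun b _ => by ring

/-- The conjugate of a right trace coupling: `(traceR B)^M i c l e = (Σ_a M_{ca} B_{ia}) · M_{el}`.
[cite: Giaquinta1983MultipleIntegrals, Ch. III §2 eq. (2.1)-(2.3)] -/
theorem Visc4.conj_traceR_apply (M : Matrix d d ℝ) (B : Matrix d d ℝ) (i c l e : d) :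
    Visc4.conj M (Visc4.traceR B) i c l e = (∑ a, M c a * B i a) * M e l := by
  rw [Visc4.conj_apply, Finset.sum_mul]
  refine Finset.sum_congr rfl fun a _ => ?_
  rw [Finset.sum_eq_single l (fun b _ hb => by simp [Visc4.traceR, Ne.symm hb])
    (fun h => (h (Finset.mem_univ l)).elim)]
  simp only [Visc4.traceR, if_true]

omit [DecidableEq d] in
/-- Conjugation preserves `(a,b)`-antisymmetry: `(Z^M) i c j e = −(Z^M) i e j c`.
[cite: Evans2010, §8.1.4.b] -/
theorem Visc4.IsDerivAntisymm.conj {Z : Visc4 d} (hZ : Visc4.IsDerivAntisymm Z) (M : Matrix d d ℝ) :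
    Visc4.IsDerivAntisymm (Visc4.conj M Z) := by
  intro i c j e
  rw [Visc4.conj_apply, Visc4.conj_apply, ← Finset.sum_neg_distrib]
  rw [Finset.sum_comm]
  refine Finset.sum_congr rfl fun a _ => ?_
  rw [← Finset.sum_neg_distrib]
  refine Finset.sum_congr rfl fun b _ => ?_
  rw [hZ i b j a]; ring

omit [DecidableEq d] in
/-- A double sum of an antisymmetric family against a symmetric one vanishes. [folklore] -/
private theorem sum_sum_mul_eq_zero_of_antisymm_symm {f g : d → d → ℝ} (hf : ∀ a b, f a b = -f b a)
    (hg : ∀ a b, g a b = g b a) : ∑ a, ∑ b, f a b * g a b = 0 := by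
  have h1 : ∑ a, ∑ b, f a b * g a b = -∑ a, ∑ b, f a b * g a b := by
    calc ∑ a, ∑ b, f a b * g a b = ∑ a, ∑ b, -(f b a * g b a) :=
          Finset.sum_congr rfl fun a _ => Finset.sum_congr rfl fun b _ => by rw [hf a b, hg a b]; ring
      _ = -∑ a, ∑ b, f b a * g b a := by simp only [Finset.sum_neg_distrib]
      _ = -∑ b, ∑ a, f b a * g b a := by rw [Finset.sum_comm]
  linarith

end Algebra

/-! ## §1 Smoothness plumbing and the test-side Piola identity -/

section Piola

variable {G : UnitAddTorus d → Matrix d d ℝ} {Ψ : UnitAddTorus d → EuclideanSpace ℝ d}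

omit [Fintype d] in
/-- Partial derivatives of constants vanish. [folklore] -/
private theorem partialDeriv_const_ti (c : ℝ) (l : d) (x : UnitAddTorus d) :
    FunctionSpaces.Torus.partialDeriv l (fun _ : UnitAddTorus d => c) x = 0 := by
  simp [FunctionSpaces.Torus.partialDeriv, FunctionSpaces.Torus.lineDeriv]

omit [DecidableEq d] in
/-- Products of smooth scalar functions are smooth. [folklore] -/
private theorem isSmooth_mul_ti {f g : UnitAddTorus d → ℝ} (hf : FunctionSpaces.Torus.IsSmooth f) (hg : FunctionSpaces.Torus.IsSmooth g) :
    FunctionSpaces.Torus.IsSmooth (fun y => f y * g y) := by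
  unfold FunctionSpaces.Torus.IsSmooth at hf hg ⊢
  exact hf.mul hg

omit [DecidableEq d] in
/-- Finite sums of smooth scalar functions are smooth. [folklore] -/
private theorem isSmooth_sum_ti {ι : Type*} (s : Finset ι) {f : ι → UnitAddTorus d → ℝ}
    (hf : ∀ i ∈ s, FunctionSpaces.Torus.IsSmooth (f i)) : FunctionSpaces.Torus.IsSmooth (fun y => ∑ i ∈ s, f i y) := by
  unfold FunctionSpaces.Torus.IsSmooth at hf ⊢
  exact ContDiff.sum fun i hi => hf i hi

omit [DecidableEq d] in
/-- A smooth function is `C¹`. [folklore] -/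
private theorem isContDiff_one_ti {F : Type*} [NormedAddCommGroup F] [NormedSpace ℝ F]
    {f : UnitAddTorus d → F} (hf : FunctionSpaces.Torus.IsSmooth f) : FunctionSpaces.Torus.IsContDiff 1 f :=
  hf.isContDiff (by simp)

omit [DecidableEq d] in
/-- Entries of the conjugated tensor `D^{G(y)}` are smooth in `y` when the entries of `G` are.
[cite: Giaquinta1983MultipleIntegrals, Ch. III §2 eq. (2.1)-(2.3)] -/
theorem isSmooth_conj_entry (hG : ∀ c a, FunctionSpaces.Torus.IsSmooth (fun y => G y c a)) (D : Visc4 d) (i c l e : d) :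
    FunctionSpaces.Torus.IsSmooth (fun y => Visc4.conj (G y) D i c l e) := by
  simp only [Visc4.conj_apply]
  exact isSmooth_sum_ti _ fun a _ => isSmooth_sum_ti _ fun b _ =>
    isSmooth_mul_ti (isSmooth_mul_ti (hG c a) (FunctionSpaces.Torus.isSmooth_const _)) (hG e b)

/-- The coordinates `y ↦ (∂_c Ψ)(y)_i` of the gradient of a smooth field are smooth. [folklore] -/
private theorem isSmooth_partialDeriv_apply_ti (hΨ : FunctionSpaces.Torus.IsSmooth Ψ) (c i : d) :
    FunctionSpaces.Torus.IsSmooth (fun y => FunctionSpaces.Torus.partialDeriv c Ψ y i) :=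
  (hΨ.partialDeriv c).apply i

/-- **Piola for the columns, unfolded**: `Σ_c ∂_c G_{ca} = 0` for every `a`.
[cite: Evans2010, §8.1.4.b] -/
theorem sum_partialDeriv_col_eq_zero
    (hGp : ∀ a, FunctionSpaces.Torus.IsDivFree (fun y => (WithLp.toLp 2 fun c => G y c a : EuclideanSpace ℝ d))) (a : d)
    (y : UnitAddTorus d) : ∑ c, FunctionSpaces.Torus.partialDeriv c (fun z => G z c a) y = 0 := by
  have h := hGp a y
  unfold FunctionSpaces.Torus.divergence at h
  simpa only [PiLp.toLp_apply] using h

/-- **TEST-SIDE PIOLA.**  For a frame with FunctionSpaces.Torus.divergence-free columns and a smooth test field with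
`∇·(G Ψ) = 0`, the `G`-trace of the test gradient vanishes pointwise: `Σ_{i,c} G_{ci} ∂_c Ψ_i = 0`
(`∇·(GΨ) = Σ_i Ψ_i ∇·G_{·i} + G:∇Ψ` by Leibniz, and the first sum vanishes by Piola).
[cite: Evans2010, §8.1.4.b] [cite: ArmstrongVicol2025, §4.1 (s_{m−1}, T_{m−1}), PDF p. 34] -/
theorem sum_mul_partialDeriv_eq_zero_of_isDivFree_distort (hG : ∀ c a, FunctionSpaces.Torus.IsSmooth (fun y => G y c a))
    (hGp : ∀ a, FunctionSpaces.Torus.IsDivFree (fun y => (WithLp.toLp 2 fun c => G y c a : EuclideanSpace ℝ d)))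
    (hΨ : FunctionSpaces.Torus.IsSmooth Ψ) (hdiv : FunctionSpaces.Torus.IsDivFree (distort G Ψ)) (y : UnitAddTorus d) :
    ∑ i, ∑ c, G y c i * FunctionSpaces.Torus.partialDeriv c Ψ y i = 0 := by
  have h := hdiv y
  unfold FunctionSpaces.Torus.divergence at h
  have e1 : ∀ c, (fun z => distort G Ψ z c) = fun z => ∑ i, G z c i * Ψ z i :=
    fun c => funext fun z => distort_apply G Ψ z c
  have hGΨ : ∀ c i, FunctionSpaces.Torus.IsContDiff 1 (fun z => G z c i * Ψ z i) :=
    fun c i => isContDiff_one_ti (isSmooth_mul_ti (hG c i) (hΨ.apply i))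
  have e2 : ∀ c, FunctionSpaces.Torus.partialDeriv c (fun z => distort G Ψ z c) y =
      ∑ i, (G y c i * FunctionSpaces.Torus.partialDeriv c Ψ y i + FunctionSpaces.Torus.partialDeriv c (fun z => G z c i) y * Ψ y i) := by
    intro c
    rw [e1 c, FunctionSpaces.Torus.partialDeriv_finset_sum _ (fun i _ => hGΨ c i)]
    refine Finset.sum_congr rfl fun i _ => ?_
    rw [FunctionSpaces.Torus.partialDeriv_mul (isContDiff_one_ti (hG c i)) (isContDiff_one_ti (hΨ.apply i)),
      FunctionSpaces.Torus.partialDeriv_apply_coord (isContDiff_one_ti hΨ)]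
  simp only [e2, Finset.sum_add_distrib] at h
  have hP : ∑ c, ∑ i, FunctionSpaces.Torus.partialDeriv c (fun z => G z c i) y * Ψ y i = 0 := by
    rw [Finset.sum_comm]
    refine Finset.sum_eq_zero fun i _ => ?_
    calc ∑ c, FunctionSpaces.Torus.partialDeriv c (fun z => G z c i) y * Ψ y i
        = (∑ c, FunctionSpaces.Torus.partialDeriv c (fun z => G z c i) y) * Ψ y i := by rw [Finset.sum_mul]
      _ = 0 := by rw [sum_partialDeriv_col_eq_zero hGp i y, zero_mul]
  rw [hP, add_zero] at h
  rw [Finset.sum_comm]; exact h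

end Piola

/-! ## §2 The three invisible families under the distorted test operator -/

section Families

variable {G : UnitAddTorus d → Matrix d d ℝ} {Ψ : UnitAddTorus d → EuclideanSpace ℝ d}

/-- **(i) LEFT TRACE COUPLINGS ARE INVISIBLE (pointwise, any frame with Piola columns).**
`𝓛^{(traceL A)^G,*} Ψ ≡ 0` for every admissible test: `(traceL A)^G_{icle} = G_{ci}(AGᵀ)_{le}`, so
`(𝓛^* Ψ)_l = Σ_e ∂_e((AGᵀ)_{le} · Σ_{ic} G_{ci}∂_cΨ_i) = 0` by the test-side Piola identity.
[cite: Evans2010, §8.1.4.b] [cite: Giaquinta1983MultipleIntegrals, Ch. III §2 eq. (2.1)-(2.3)] -/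
theorem viscAdjVar_conj_traceL_eq_zero (hG : ∀ c a, FunctionSpaces.Torus.IsSmooth (fun y => G y c a))
    (hGp : ∀ a, FunctionSpaces.Torus.IsDivFree (fun y => (WithLp.toLp 2 fun c => G y c a : EuclideanSpace ℝ d)))
    (hΨ : FunctionSpaces.Torus.IsSmooth Ψ) (hdiv : FunctionSpaces.Torus.IsDivFree (distort G Ψ)) (A : Matrix d d ℝ) (x : UnitAddTorus d) :
    viscAdjVar (fun y => Visc4.conj (G y) (Visc4.traceL A)) Ψ x = 0 := by
  ext l
  rw [viscAdjVar_apply, PiLp.zero_apply]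
  -- the summands are smooth
  have hf : ∀ i c e, FunctionSpaces.Torus.IsContDiff 1
      (fun y => Visc4.conj (G y) (Visc4.traceL A) i c l e * FunctionSpaces.Torus.partialDeriv c Ψ y i) := fun i c e =>
    isContDiff_one_ti (isSmooth_mul_ti (isSmooth_conj_entry hG _ i c l e) (isSmooth_partialDeriv_apply_ti hΨ c i))
  -- the function summed over `i, c` vanishes identically, for each `e`
  have hzero : ∀ e, (fun y => ∑ i, ∑ c, Visc4.conj (G y) (Visc4.traceL A) i c l e * FunctionSpaces.Torus.partialDeriv c Ψ y i) =
      fun _ => (0 : ℝ) := by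
    intro e; funext y
    have key := sum_mul_partialDeriv_eq_zero_of_isDivFree_distort hG hGp hΨ hdiv y
    calc ∑ i, ∑ c, Visc4.conj (G y) (Visc4.traceL A) i c l e * FunctionSpaces.Torus.partialDeriv c Ψ y i
        = ∑ i, ∑ c, (∑ b, A l b * G y e b) * (G y c i * FunctionSpaces.Torus.partialDeriv c Ψ y i) :=
          Finset.sum_congr rfl fun i _ => Finset.sum_congr rfl fun c _ => by
            rw [Visc4.conj_traceL_apply]; ring
      _ = (∑ b, A l b * G y e b) * ∑ i, ∑ c, G y c i * FunctionSpaces.Torus.partialDeriv c Ψ y i := by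
          simp only [Finset.mul_sum]
      _ = 0 := by rw [key, mul_zero]
  calc ∑ i, ∑ c, ∑ e, FunctionSpaces.Torus.partialDeriv e
          (fun y => Visc4.conj (G y) (Visc4.traceL A) i c l e * FunctionSpaces.Torus.partialDeriv c Ψ y i) x
      = ∑ e, ∑ i, ∑ c, FunctionSpaces.Torus.partialDeriv e
          (fun y => Visc4.conj (G y) (Visc4.traceL A) i c l e * FunctionSpaces.Torus.partialDeriv c Ψ y i) x := by
        exact (Finset.sum_congr rfl fun i _ => Finset.sum_comm).trans Finset.sum_comm
    _ = ∑ e, FunctionSpaces.Torus.partialDeriv e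
          (fun y => ∑ i, ∑ c, Visc4.conj (G y) (Visc4.traceL A) i c l e * FunctionSpaces.Torus.partialDeriv c Ψ y i) x := by
        refine Finset.sum_congr rfl fun e _ => ?_
        rw [FunctionSpaces.Torus.partialDeriv_finset_sum _ (fun i _ => ?_)]
        · exact Finset.sum_congr rfl fun i _ => (FunctionSpaces.Torus.partialDeriv_finset_sum _ (fun c _ => hf i c e) e x).symm
        · unfold FunctionSpaces.Torus.IsContDiff
          exact ContDiff.sum fun c _ => hf i c e
    _ = 0 := by simp only [hzero, partialDeriv_const_ti, Finset.sum_const_zero]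

/-- **(ii) RIGHT TRACE COUPLINGS ARE A DISTORTED GRADIENT (pointwise, any frame with Piola columns).**
`(traceR B)^G_{icle} = (GBᵀ)_{ci} G_{el}`, so `(𝓛^* Ψ)_l = Σ_e ∂_e(G_{el} φ) = Σ_e G_{el} ∂_e φ = (Gᵀ∇φ)_l`
with the smooth scalar `φ = Σ_{ic} (GBᵀ)_{ci} ∂_cΨ_i` (Piola kills `φ Σ_e ∂_e G_{el}`); such a field pairs to
zero against every `w` with `∇·(Gw) = 0` weakly.
[cite: Evans2010, §8.1.4.b] [cite: Giaquinta1983MultipleIntegrals, Ch. III §2 eq. (2.1)-(2.3)] -/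
theorem viscAdjVar_conj_traceR_eq (hG : ∀ c a, FunctionSpaces.Torus.IsSmooth (fun y => G y c a))
    (hGp : ∀ a, FunctionSpaces.Torus.IsDivFree (fun y => (WithLp.toLp 2 fun c => G y c a : EuclideanSpace ℝ d)))
    (hΨ : FunctionSpaces.Torus.IsSmooth Ψ) (B : Matrix d d ℝ) (x : UnitAddTorus d) :
    viscAdjVar (fun y => Visc4.conj (G y) (Visc4.traceR B)) Ψ x =
      distort (fun y => (G y).transpose)
        (FunctionSpaces.Torus.gradient fun y => ∑ i, ∑ c, (∑ a, G y c a * B i a) * FunctionSpaces.Torus.partialDeriv c Ψ y i) x := by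
  set φ : UnitAddTorus d → ℝ := fun y => ∑ i, ∑ c, (∑ a, G y c a * B i a) * FunctionSpaces.Torus.partialDeriv c Ψ y i with hφ
  have hm : ∀ c i, FunctionSpaces.Torus.IsSmooth (fun y => ∑ a, G y c a * B i a) := fun c i =>
    isSmooth_sum_ti _ fun a _ => isSmooth_mul_ti (hG c a) (FunctionSpaces.Torus.isSmooth_const _)
  have hφs : FunctionSpaces.Torus.IsSmooth φ := isSmooth_sum_ti _ fun i _ => isSmooth_sum_ti _ fun c _ =>
    isSmooth_mul_ti (hm c i) (isSmooth_partialDeriv_apply_ti hΨ c i)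
  ext l
  rw [viscAdjVar_apply]
  have hf : ∀ i c e, FunctionSpaces.Torus.IsContDiff 1
      (fun y => Visc4.conj (G y) (Visc4.traceR B) i c l e * FunctionSpaces.Torus.partialDeriv c Ψ y i) := fun i c e =>
    isContDiff_one_ti (isSmooth_mul_ti (isSmooth_conj_entry hG _ i c l e) (isSmooth_partialDeriv_apply_ti hΨ c i))
  have hcomb : ∀ e, (fun y => ∑ i, ∑ c, Visc4.conj (G y) (Visc4.traceR B) i c l e * FunctionSpaces.Torus.partialDeriv c Ψ y i) =
      fun y => G y e l * φ y := by
    intro e; funext y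
    simp only [hφ, Finset.mul_sum]
    refine Finset.sum_congr rfl fun i _ => Finset.sum_congr rfl fun c _ => ?_
    rw [Visc4.conj_traceR_apply]; ring
  calc ∑ i, ∑ c, ∑ e, FunctionSpaces.Torus.partialDeriv e
          (fun y => Visc4.conj (G y) (Visc4.traceR B) i c l e * FunctionSpaces.Torus.partialDeriv c Ψ y i) x
      = ∑ e, ∑ i, ∑ c, FunctionSpaces.Torus.partialDeriv e
          (fun y => Visc4.conj (G y) (Visc4.traceR B) i c l e * FunctionSpaces.Torus.partialDeriv c Ψ y i) x := by
        exact (Finset.sum_congr rfl fun i _ => Finset.sum_comm).trans Finset.sum_comm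
    _ = ∑ e, FunctionSpaces.Torus.partialDeriv e (fun y => G y e l * φ y) x := by
        refine Finset.sum_congr rfl fun e _ => ?_
        rw [← hcomb e, FunctionSpaces.Torus.partialDeriv_finset_sum _ (fun i _ => ?_)]
        · exact Finset.sum_congr rfl fun i _ => (FunctionSpaces.Torus.partialDeriv_finset_sum _ (fun c _ => hf i c e) e x).symm
        · unfold FunctionSpaces.Torus.IsContDiff
          exact ContDiff.sum fun c _ => hf i c e
    _ = ∑ e, (G x e l * FunctionSpaces.Torus.partialDeriv e φ x + FunctionSpaces.Torus.partialDeriv e (fun y => G y e l) x * φ x) :=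
        Finset.sum_congr rfl fun e _ => FunctionSpaces.Torus.partialDeriv_mul (isContDiff_one_ti (hG e l)) (isContDiff_one_ti hφs) e x
    _ = ∑ e, G x e l * FunctionSpaces.Torus.partialDeriv e φ x + (∑ e, FunctionSpaces.Torus.partialDeriv e (fun y => G y e l) x) * φ x := by
        rw [Finset.sum_add_distrib, Finset.sum_mul]
    _ = ∑ e, G x e l * FunctionSpaces.Torus.partialDeriv e φ x := by
        rw [sum_partialDeriv_col_eq_zero hGp l x, zero_mul, add_zero]
    _ = distort (fun y => (G y).transpose) (FunctionSpaces.Torus.gradient φ) x l := by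
        rw [distort_apply]
        exact Finset.sum_congr rfl fun e _ => by
          rw [Matrix.transpose_apply, FunctionSpaces.Torus.gradient_apply (isContDiff_one_ti hφs)]

omit [DecidableEq d] in
/-- Transposition under the pairing: `⟪v, Gᵀ z⟫ = ⟪G v, z⟫` pointwise. [folklore] -/
private theorem inner_distort_transpose_ti (G : UnitAddTorus d → Matrix d d ℝ)
    (v z : UnitAddTorus d → EuclideanSpace ℝ d) (y : UnitAddTorus d) :
    ⟪v y, distort (fun y => (G y).transpose) z y⟫_ℝ = ⟪distort G v y, z y⟫_ℝ := by
  rw [PiLp.inner_apply, PiLp.inner_apply]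
  simp only [distort_apply, Matrix.transpose_apply, RCLike.inner_apply, conj_trivial, Finset.mul_sum,
    Finset.sum_mul]
  rw [Finset.sum_comm]
  refine Finset.sum_congr rfl fun a _ => Finset.sum_congr rfl fun c _ => ?_
  ring

/-- **(ii′) Right trace couplings pair to zero against `G`-solenoidal fields**: if `∇·(G v) = 0` weakly
then `∫⟪v, 𝓛^{(traceR B)^G,*} Ψ⟫ = ∫⟪G v, ∇φ⟫ = 0`.
[cite: Evans2010, §8.1.4.b] [cite: Giaquinta1983MultipleIntegrals, Ch. III §2 eq. (2.1)-(2.3)] -/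
theorem integral_inner_viscAdjVar_conj_traceR_eq_zero (hG : ∀ c a, FunctionSpaces.Torus.IsSmooth (fun y => G y c a))
    (hGp : ∀ a, FunctionSpaces.Torus.IsDivFree (fun y => (WithLp.toLp 2 fun c => G y c a : EuclideanSpace ℝ d)))
    (hΨ : FunctionSpaces.Torus.IsSmooth Ψ) (B : Matrix d d ℝ) {v : UnitAddTorus d → EuclideanSpace ℝ d}
    (hv : FunctionSpaces.Torus.IsWeaklyDivFree (distort G v)) :
    ∫ x, ⟪v x, viscAdjVar (fun y => Visc4.conj (G y) (Visc4.traceR B)) Ψ x⟫_ℝ = 0 := by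
  have hm : ∀ c i, FunctionSpaces.Torus.IsSmooth (fun y => ∑ a, G y c a * B i a) := fun c i =>
    isSmooth_sum_ti _ fun a _ => isSmooth_mul_ti (hG c a) (FunctionSpaces.Torus.isSmooth_const _)
  have hφs : FunctionSpaces.Torus.IsSmooth (fun y => ∑ i, ∑ c, (∑ a, G y c a * B i a) * FunctionSpaces.Torus.partialDeriv c Ψ y i) :=
    isSmooth_sum_ti _ fun i _ => isSmooth_sum_ti _ fun c _ =>
      isSmooth_mul_ti (hm c i) (isSmooth_partialDeriv_apply_ti hΨ c i)
  have e : (fun x => ⟪v x, viscAdjVar (fun y => Visc4.conj (G y) (Visc4.traceR B)) Ψ x⟫_ℝ) =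
      fun x => ⟪distort G v x, FunctionSpaces.Torus.gradient
        (fun y => ∑ i, ∑ c, (∑ a, G y c a * B i a) * FunctionSpaces.Torus.partialDeriv c Ψ y i) x⟫_ℝ := by
    funext x
    rw [viscAdjVar_conj_traceR_eq hG hGp hΨ B x, inner_distort_transpose_ti]
  rw [e]
  exact hv _ hφs

/-! ### (iii) The antisymmetric family and the torsion of the frame -/

/-- **TORSION SYMMETRY OF A HOLONOMIC FRAME.**  If `G·(1 + ∇φ) = 1` for a smooth periodic
displacement `φ` (so `G = (∇X)⁻¹`, `X(y) = y + φ(y)`, and the columns `Y_a = Σ_e G_{ea}∂_e` of `G` are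
the coordinate fields `∂/∂x_a`), then `Y_b(G_{ca}) = Y_a(G_{cb})`:
`Σ_e G_{eb} ∂_e G_{ca}` is symmetric in `(a, b)` — the frame is torsion-free (`[Y_a, Y_b] = 0`).
Proof: `∂_e G = −G (∂_e J) G` from `GJ = JG = 1`, and `(∂_e J)_{pr} = ∂_e∂_r φ_p` is symmetric in
`(e, r)` (Schwarz). [cite: Evans2010, §8.1.4.b] [cite: ArmstrongVicol2025, §4.1 (s_{m−1}, T_{m−1}), PDF p. 34] -/
theorem holonomic_torsion_symm (hG : ∀ c a, FunctionSpaces.Torus.IsSmooth (fun y => G y c a))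
    (hhol : ∃ φ : UnitAddTorus d → EuclideanSpace ℝ d, FunctionSpaces.Torus.IsSmooth φ ∧
      ∀ y, G y * Matrix.of (fun a c => (1 : Matrix d d ℝ) a c + FunctionSpaces.Torus.partialDeriv c (fun z => φ z a) y) = 1)
    (c a b : d) (x : UnitAddTorus d) :
    ∑ e, G x e b * FunctionSpaces.Torus.partialDeriv e (fun z => G z c a) x = ∑ e, G x e a * FunctionSpaces.Torus.partialDeriv e (fun z => G z c b) x := by
  obtain ⟨φ, hφ, hGJ⟩ := hhol
  have hφa : ∀ a, FunctionSpaces.Torus.IsSmooth (fun z => φ z a) := fun a => hφ.apply a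
  -- the Jacobian `J = 1 + ∇φ` as a matrix field with its entry formula
  obtain ⟨J, hJ⟩ : ∃ J : UnitAddTorus d → Matrix d d ℝ,
      ∀ y p q, J y p q = (1 : Matrix d d ℝ) p q + FunctionSpaces.Torus.partialDeriv q (fun z => φ z p) y :=
    ⟨fun y => Matrix.of fun p q => (1 : Matrix d d ℝ) p q + FunctionSpaces.Torus.partialDeriv q (fun z => φ z p) y,
      fun _ _ _ => rfl⟩
  have hGJ' : ∀ y, G y * J y = 1 := by
    intro y
    have e : J y = Matrix.of (fun a c => (1 : Matrix d d ℝ) a c + FunctionSpaces.Torus.partialDeriv c (fun z => φ z a) y) := by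
      ext p q; rw [hJ, Matrix.of_apply]
    rw [e]; exact hGJ y
  have hJG : ∀ y, J y * G y = 1 := fun y => mul_eq_one_comm.mp (hGJ' y)
  have hJs : ∀ p q, FunctionSpaces.Torus.IsSmooth (fun y => J y p q) := by
    intro p q
    have e1 : (fun y => J y p q) = fun y => (1 : Matrix d d ℝ) p q + FunctionSpaces.Torus.partialDeriv q (fun z => φ z p) y :=
      funext fun y => hJ y p q
    rw [e1]; exact (FunctionSpaces.Torus.isSmooth_const _).add ((hφa p).partialDeriv q)
  -- `∂_e J_{pq} = ∂_e ∂_q φ_p`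
  have hJd : ∀ e p q, FunctionSpaces.Torus.partialDeriv e (fun y => J y p q) x =
      FunctionSpaces.Torus.partialDeriv e (FunctionSpaces.Torus.partialDeriv q (fun z => φ z p)) x := by
    intro e p q
    have e1 : (fun y => J y p q) = (fun _ => (1 : Matrix d d ℝ) p q) + FunctionSpaces.Torus.partialDeriv q (fun z => φ z p) :=
      funext fun y => by rw [Pi.add_apply]; exact hJ y p q
    rw [e1, FunctionSpaces.Torus.partialDeriv_add (FunctionSpaces.Torus.isContDiff_const _) (isContDiff_one_ti ((hφa p).partialDeriv q)),
      Pi.add_apply, partialDeriv_const_ti, zero_add]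
  -- the derivative matrices `Gd e = ∂_e G`, `Jd e = ∂_e J` (entries), at the point `x`
  obtain ⟨Gd, hGd⟩ : ∃ Gd : d → Matrix d d ℝ,
      ∀ e c' a', Gd e c' a' = FunctionSpaces.Torus.partialDeriv e (fun z => G z c' a') x :=
    ⟨fun e => Matrix.of fun c' a' => FunctionSpaces.Torus.partialDeriv e (fun z => G z c' a') x, fun _ _ _ => rfl⟩
  obtain ⟨Jd, hJdE⟩ : ∃ Jd : d → Matrix d d ℝ,
      ∀ e p q, Jd e p q = FunctionSpaces.Torus.partialDeriv e (FunctionSpaces.Torus.partialDeriv q (fun z => φ z p)) x :=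
    ⟨fun e => Matrix.of fun p q => FunctionSpaces.Torus.partialDeriv e (FunctionSpaces.Torus.partialDeriv q (fun z => φ z p)) x, fun _ _ _ => rfl⟩
  -- differentiate `G J = 1`: `G (∂_e J) + (∂_e G) J = 0`
  have hE : ∀ e, G x * Jd e + Gd e * J x = 0 := by
    intro e
    ext c' q
    have hconst : (fun y => ∑ p, G y c' p * J y p q) = fun _ => (1 : Matrix d d ℝ) c' q := by
      funext y; rw [← Matrix.mul_apply, hGJ' y]
    have hder := congrArg (fun f => FunctionSpaces.Torus.partialDeriv e f x) hconst
    simp only [partialDeriv_const_ti] at hder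
    rw [FunctionSpaces.Torus.partialDeriv_finset_sum _
      (fun p _ => isContDiff_one_ti (isSmooth_mul_ti (hG c' p) (hJs p q)))] at hder
    have hder' : ∑ p, (G x c' p * Jd e p q + Gd e c' p * J x p q) = 0 := by
      rw [← hder]
      refine Finset.sum_congr rfl fun p _ => ?_
      rw [FunctionSpaces.Torus.partialDeriv_mul (isContDiff_one_ti (hG c' p)) (isContDiff_one_ti (hJs p q)), hJd, hJdE, hGd]
    rw [Matrix.add_apply, Matrix.mul_apply, Matrix.mul_apply, Matrix.zero_apply, ← Finset.sum_add_distrib]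
    exact hder'
  -- hence `∂_e G = −G (∂_e J) G`
  have hGdE : ∀ e, Gd e = -(G x * Jd e * G x) := by
    intro e
    have h1 := congrArg (· * G x) (hE e)
    simp only [Matrix.add_mul, Matrix.zero_mul] at h1
    rw [Matrix.mul_assoc (Gd e), hJG x, Matrix.mul_one] at h1
    exact eq_neg_of_add_eq_zero_right h1
  -- the Hessians `H p = ∇²φ_p` (symmetric by Schwarz) and the symmetric matrices `Gᵀ (H p) G`
  obtain ⟨H, hH⟩ : ∃ H : d → Matrix d d ℝ, ∀ p e r, H p e r = Jd e p r :=
    ⟨fun p => Matrix.of fun e r => Jd e p r, fun _ _ _ => rfl⟩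
  have hHsymm : ∀ p, (H p).transpose = H p := fun p => by
    ext e r
    rw [Matrix.transpose_apply, hH, hH, hJdE, hJdE]
    exact FunctionSpaces.Torus.partialDeriv_comm (hφa p) r e x
  have hS : ∀ p, ((G x).transpose * H p * G x).transpose = (G x).transpose * H p * G x := fun p => by
    rw [Matrix.transpose_mul, Matrix.transpose_mul, Matrix.transpose_transpose, hHsymm p, Matrix.mul_assoc]
  have hM : ∀ p a' b', ((G x).transpose * H p * G x) b' a' = ∑ e, ∑ r, G x e b' * Jd e p r * G x r a' := by
    intro p a' b'
    rw [Matrix.mul_apply]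
    simp only [Matrix.mul_apply, Matrix.transpose_apply, Finset.sum_mul, hH]
    rw [Finset.sum_comm]
  -- the torsion `Y_{b'}(G_{c a'})` in terms of the symmetric matrices
  have hY : ∀ a' b', ∑ e, G x e b' * FunctionSpaces.Torus.partialDeriv e (fun z => G z c a') x =
      -∑ p, G x c p * ((G x).transpose * H p * G x) b' a' := by
    intro a' b'
    have e1 : ∀ e, FunctionSpaces.Torus.partialDeriv e (fun z => G z c a') x = -∑ r, (∑ p, G x c p * Jd e p r) * G x r a' := by
      intro e
      rw [← hGd]
      have := congrArg (fun M : Matrix d d ℝ => M c a') (hGdE e)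
      simp only [Matrix.neg_apply, Matrix.mul_apply] at this
      exact this
    calc ∑ e, G x e b' * FunctionSpaces.Torus.partialDeriv e (fun z => G z c a') x
        = ∑ e, ∑ r, ∑ p, -(G x e b' * Jd e p r * G x r a' * G x c p) := by
          refine Finset.sum_congr rfl fun e _ => ?_
          rw [e1 e, mul_neg, Finset.mul_sum, ← Finset.sum_neg_distrib]
          refine Finset.sum_congr rfl fun r _ => ?_
          rw [Finset.sum_mul, Finset.mul_sum, ← Finset.sum_neg_distrib]
          exact Finset.sum_congr rfl fun p _ => by ring
      _ = ∑ p, ∑ e, ∑ r, -(G x e b' * Jd e p r * G x r a' * G x c p) :=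
          (Finset.sum_congr rfl fun e _ => Finset.sum_comm).trans Finset.sum_comm
      _ = -∑ p, G x c p * ((G x).transpose * H p * G x) b' a' := by
          rw [← Finset.sum_neg_distrib]
          refine Finset.sum_congr rfl fun p _ => ?_
          rw [hM, Finset.mul_sum, ← Finset.sum_neg_distrib]
          refine Finset.sum_congr rfl fun e _ => ?_
          rw [Finset.mul_sum, ← Finset.sum_neg_distrib]
          exact Finset.sum_congr rfl fun r _ => by ring
  rw [hY a b, hY b a]
  congr 1
  refine Finset.sum_congr rfl fun p _ => ?_
  rw [← Matrix.transpose_apply ((G x).transpose * H p * G x) a b, hS p]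

/-- **The divergence of the conjugated antisymmetric tensor vanishes for holonomic frames**:
`Σ_e ∂_e (Z^G)_{icje} = Σ_{ab} Z_{iajb} (Y_b(G_{ca}) + G_{ca} ∇·G_{·b}) = 0` (Piola kills the second term,
torsion symmetry against the antisymmetry of `Z` the first). [cite: Evans2010, §8.1.4.b] -/
theorem sum_partialDeriv_conj_eq_zero_of_isDerivAntisymm (hG : ∀ c a, FunctionSpaces.Torus.IsSmooth (fun y => G y c a))
    (hGp : ∀ a, FunctionSpaces.Torus.IsDivFree (fun y => (WithLp.toLp 2 fun c => G y c a : EuclideanSpace ℝ d)))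
    (hhol : ∃ φ : UnitAddTorus d → EuclideanSpace ℝ d, FunctionSpaces.Torus.IsSmooth φ ∧
      ∀ y, G y * Matrix.of (fun a c => (1 : Matrix d d ℝ) a c + FunctionSpaces.Torus.partialDeriv c (fun z => φ z a) y) = 1)
    {Z : Visc4 d} (hZ : Visc4.IsDerivAntisymm Z) (i c j : d) (x : UnitAddTorus d) :
    ∑ e, FunctionSpaces.Torus.partialDeriv e (fun y => Visc4.conj (G y) Z i c j e) x = 0 := by
  have hGG : ∀ a b e, FunctionSpaces.Torus.IsContDiff 1 (fun y => G y c a * G y e b) :=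
    fun a b e => isContDiff_one_ti (isSmooth_mul_ti (hG c a) (hG e b))
  have hZGG : ∀ a b e, FunctionSpaces.Torus.IsContDiff 1 (fun y => Z i a j b * (G y c a * G y e b)) :=
    fun a b e => isContDiff_one_ti (isSmooth_mul_ti (FunctionSpaces.Torus.isSmooth_const _) (isSmooth_mul_ti (hG c a) (hG e b)))
  have e1 : ∀ e, (fun y => Visc4.conj (G y) Z i c j e) = fun y => ∑ a, ∑ b, Z i a j b * (G y c a * G y e b) := by
    intro e; funext y; rw [Visc4.conj_apply]
    exact Finset.sum_congr rfl fun a _ => Finset.sum_congr rfl fun b _ => by ring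
  have e2 : ∀ e, FunctionSpaces.Torus.partialDeriv e (fun y => Visc4.conj (G y) Z i c j e) x =
      ∑ a, ∑ b, Z i a j b * (G x c a * FunctionSpaces.Torus.partialDeriv e (fun y => G y e b) x +
        FunctionSpaces.Torus.partialDeriv e (fun y => G y c a) x * G x e b) := by
    intro e
    rw [e1 e, FunctionSpaces.Torus.partialDeriv_finset_sum _ (fun a _ => ?_)]
    · refine Finset.sum_congr rfl fun a _ => ?_
      rw [FunctionSpaces.Torus.partialDeriv_finset_sum _ (fun b _ => hZGG a b e)]
      refine Finset.sum_congr rfl fun b _ => ?_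
      rw [show (fun y => Z i a j b * (G y c a * G y e b)) = Z i a j b • (fun y => G y c a * G y e b) from rfl,
        FunctionSpaces.Torus.partialDeriv_const_smul (hGG a b e), Pi.smul_apply, smul_eq_mul,
        FunctionSpaces.Torus.partialDeriv_mul (isContDiff_one_ti (hG c a)) (isContDiff_one_ti (hG e b))]
    · unfold FunctionSpaces.Torus.IsContDiff
      exact ContDiff.sum fun b _ => hZGG a b e
  simp only [e2]
  rw [Finset.sum_comm]
  have e3 : ∀ a, ∑ e, ∑ b, Z i a j b * (G x c a * FunctionSpaces.Torus.partialDeriv e (fun y => G y e b) x +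
      FunctionSpaces.Torus.partialDeriv e (fun y => G y c a) x * G x e b) =
      ∑ b, Z i a j b * ∑ e, G x e b * FunctionSpaces.Torus.partialDeriv e (fun y => G y c a) x := by
    intro a
    rw [Finset.sum_comm]
    refine Finset.sum_congr rfl fun b _ => ?_
    rw [← Finset.mul_sum, Finset.sum_add_distrib]
    congr 1
    rw [← Finset.mul_sum, sum_partialDeriv_col_eq_zero hGp b x, mul_zero, zero_add]
    exact Finset.sum_congr rfl fun e _ => by ring
  simp only [e3]
  exact sum_sum_mul_eq_zero_of_antisymm_symm (fun a b => hZ i a j b)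
    (fun a b => holonomic_torsion_symm hG hhol c a b x)

/-- **(iii) THE ANTISYMMETRIC FAMILY IS INVISIBLE FOR HOLONOMIC FRAMES (pointwise).**  For `Z`
`(a,b)`-antisymmetric and a smooth frame `G` with Piola columns and `G·(1+∇φ) = 1`:
`𝓛^{Z^G,*} Ψ ≡ 0` — the second-order part vanishes since `Z^G` is `(c,e)`-antisymmetric and `∂_e∂_cΨ`
symmetric, the first-order part is `Σ_{ic} (Σ_e ∂_e Z^G_{icle}) ∂_cΨ_i = 0` by the torsion identity.
[cite: Evans2010, §8.1.4.b] [cite: Giaquinta1983MultipleIntegrals, Ch. III §2 eq. (2.1)-(2.3)] -/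
theorem viscAdjVar_conj_eq_zero_of_isDerivAntisymm (hG : ∀ c a, FunctionSpaces.Torus.IsSmooth (fun y => G y c a))
    (hGp : ∀ a, FunctionSpaces.Torus.IsDivFree (fun y => (WithLp.toLp 2 fun c => G y c a : EuclideanSpace ℝ d)))
    (hhol : ∃ φ : UnitAddTorus d → EuclideanSpace ℝ d, FunctionSpaces.Torus.IsSmooth φ ∧
      ∀ y, G y * Matrix.of (fun a c => (1 : Matrix d d ℝ) a c + FunctionSpaces.Torus.partialDeriv c (fun z => φ z a) y) = 1)
    (hΨ : FunctionSpaces.Torus.IsSmooth Ψ) {Z : Visc4 d} (hZ : Visc4.IsDerivAntisymm Z) (x : UnitAddTorus d) :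
    viscAdjVar (fun y => Visc4.conj (G y) Z) Ψ x = 0 := by
  ext l
  rw [viscAdjVar_apply, PiLp.zero_apply]
  have e1 : ∀ i c e, FunctionSpaces.Torus.partialDeriv e (fun y => Visc4.conj (G y) Z i c l e * FunctionSpaces.Torus.partialDeriv c Ψ y i) x =
      Visc4.conj (G x) Z i c l e * FunctionSpaces.Torus.partialDeriv e (fun y => FunctionSpaces.Torus.partialDeriv c Ψ y i) x +
        FunctionSpaces.Torus.partialDeriv e (fun y => Visc4.conj (G y) Z i c l e) x * FunctionSpaces.Torus.partialDeriv c Ψ x i :=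
    fun i c e => FunctionSpaces.Torus.partialDeriv_mul (isContDiff_one_ti (isSmooth_conj_entry hG Z i c l e))
      (isContDiff_one_ti (isSmooth_partialDeriv_apply_ti hΨ c i)) e x
  simp only [e1, Finset.sum_add_distrib]
  have h2 : ∀ i, ∑ c, ∑ e, Visc4.conj (G x) Z i c l e *
      FunctionSpaces.Torus.partialDeriv e (fun y => FunctionSpaces.Torus.partialDeriv c Ψ y i) x = 0 := by
    intro i
    refine sum_sum_mul_eq_zero_of_antisymm_symm (fun c e => hZ.conj (G x) i c l e) fun c e => ?_
    rw [FunctionSpaces.Torus.partialDeriv_apply_coord (isContDiff_one_ti (hΨ.partialDeriv c)),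
      FunctionSpaces.Torus.partialDeriv_apply_coord (isContDiff_one_ti (hΨ.partialDeriv e)), FunctionSpaces.Torus.partialDeriv_comm hΨ e c x]
  have h3 : ∀ i c, ∑ e, FunctionSpaces.Torus.partialDeriv e (fun y => Visc4.conj (G y) Z i c l e) x *
      FunctionSpaces.Torus.partialDeriv c Ψ x i = 0 := by
    intro i c
    rw [← Finset.sum_mul, sum_partialDeriv_conj_eq_zero_of_isDerivAntisymm hG hGp hhol hZ i c l x, zero_mul]
  simp only [h2, h3, Finset.sum_const_zero, add_zero]

end Families

/-! ## §3 T♮2: transverse-class invariance of the distorted weak class (holonomic frames) -/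

section ClassInvariance

variable {Gs : UnitAddTorus d → Matrix d d ℝ} {Ψs : UnitAddTorus d → EuclideanSpace ℝ d}

/-- The distorted gradient field `Gᵀ ∇φ` of (ii) is smooth (smooth frame slice, smooth test slice), so
`𝓛^{(traceR B)^G,*} Ψ` is continuous. [cite: Giaquinta1983MultipleIntegrals, Ch. III §2 eq. (2.1)-(2.3)] -/
theorem continuous_viscAdjVar_conj_traceR (hG : ∀ c a, FunctionSpaces.Torus.IsSmooth (fun y => Gs y c a))
    (hGp : ∀ a, FunctionSpaces.Torus.IsDivFree (fun y => (WithLp.toLp 2 fun c => Gs y c a : EuclideanSpace ℝ d)))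
    (hΨ : FunctionSpaces.Torus.IsSmooth Ψs) (B : Matrix d d ℝ) :
    Continuous (viscAdjVar (fun y => Visc4.conj (Gs y) (Visc4.traceR B)) Ψs) := by
  have e : viscAdjVar (fun y => Visc4.conj (Gs y) (Visc4.traceR B)) Ψs =
      distort (fun y => (Gs y).transpose) (FunctionSpaces.Torus.gradient fun y => ∑ i, ∑ c, (∑ a, Gs y c a * B i a) *
        FunctionSpaces.Torus.partialDeriv c Ψs y i) := funext fun x => viscAdjVar_conj_traceR_eq hG hGp hΨ B x
  rw [e]
  have hm : ∀ c i, FunctionSpaces.Torus.IsSmooth (fun y => ∑ a, Gs y c a * B i a) := fun c i =>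
    isSmooth_sum_ti _ fun a _ => isSmooth_mul_ti (hG c a) (FunctionSpaces.Torus.isSmooth_const _)
  have hφs : FunctionSpaces.Torus.IsSmooth (fun y => ∑ i, ∑ c, (∑ a, Gs y c a * B i a) * FunctionSpaces.Torus.partialDeriv c Ψs y i) :=
    isSmooth_sum_ti _ fun i _ => isSmooth_sum_ti _ fun c _ =>
      isSmooth_mul_ti (hm c i) (isSmooth_partialDeriv_apply_ti hΨ c i)
  exact (isSmooth_distort (fun a c => by simpa only [Matrix.transpose_apply] using hG c a) hφs.gradient).continuous

/-- **The distorted test operator only sees the transverse class (pointwise + one weak pairing).**  For a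
smooth frame slice with Piola columns and `G·(1+∇φ) = 1`, a smooth test slice with `∇·(GΨ) = 0`, and
`𝔸' = 𝔸 + traceL A + traceR B + Z` (`Z` `(a,b)`-antisymmetric):
`𝓛^{𝔸'^G,*} Ψ = 𝓛^{𝔸^G,*} Ψ + 𝓛^{(traceR B)^G,*} Ψ` pointwise (families (i) and (iii) vanish).
[cite: Giaquinta1983MultipleIntegrals, Ch. III §2 eq. (2.1)-(2.3)] [cite: Evans2010, §8.1.4.b] -/
theorem viscAdjVar_conj_add_decomp (hG : ∀ c a, FunctionSpaces.Torus.IsSmooth (fun y => Gs y c a))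
    (hGp : ∀ a, FunctionSpaces.Torus.IsDivFree (fun y => (WithLp.toLp 2 fun c => Gs y c a : EuclideanSpace ℝ d)))
    (hhol : ∃ φ : UnitAddTorus d → EuclideanSpace ℝ d, FunctionSpaces.Torus.IsSmooth φ ∧
      ∀ y, Gs y * Matrix.of (fun a c => (1 : Matrix d d ℝ) a c + FunctionSpaces.Torus.partialDeriv c (fun z => φ z a) y) = 1)
    (hΨ : FunctionSpaces.Torus.IsSmooth Ψs) (hdiv : FunctionSpaces.Torus.IsDivFree (distort Gs Ψs)) (𝔸 : Visc4 d) (Am Bm : Matrix d d ℝ)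
    {Z : Visc4 d} (hZ : Visc4.IsDerivAntisymm Z) (x : UnitAddTorus d) :
    viscAdjVar (fun y => Visc4.conj (Gs y) (𝔸 + Visc4.traceL Am + Visc4.traceR Bm + Z)) Ψs x =
      viscAdjVar (fun y => Visc4.conj (Gs y) 𝔸) Ψs x +
        viscAdjVar (fun y => Visc4.conj (Gs y) (Visc4.traceR Bm)) Ψs x := by
  have h1 : ∀ D : Visc4 d, ∀ i c l e, FunctionSpaces.Torus.IsContDiff 1 (fun y => Visc4.conj (Gs y) D i c l e) :=
    fun D i c l e => isContDiff_one_ti (isSmooth_conj_entry hG D i c l e)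
  have hadd : ∀ D₁ D₂ : Visc4 d, viscAdjVar (fun y => Visc4.conj (Gs y) (D₁ + D₂)) Ψs x =
      viscAdjVar (fun y => Visc4.conj (Gs y) D₁) Ψs x + viscAdjVar (fun y => Visc4.conj (Gs y) D₂) Ψs x := by
    intro D₁ D₂
    rw [show (fun y => Visc4.conj (Gs y) (D₁ + D₂)) = fun y => Visc4.conj (Gs y) D₁ + Visc4.conj (Gs y) D₂ from
      funext fun y => Visc4.conj_add _ _ _]
    exact viscAdjVar_add_tensor (h1 D₁) (h1 D₂) hΨ x
  rw [hadd, hadd, hadd, viscAdjVar_conj_traceL_eq_zero hG hGp hΨ hdiv Am x,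
    viscAdjVar_conj_eq_zero_of_isDerivAntisymm hG hGp hhol hΨ hZ x, add_zero, add_zero]

namespace IsWeakTensorPassiveVectorDistortedOn

variable {A T : ℝ} {𝔸 𝔸' : Visc4 d} {b w : ℝ → UnitAddTorus d → EuclideanSpace ℝ d}
  {G : ℝ → UnitAddTorus d → Matrix d d ℝ} {w₀ : UnitAddTorus d → EuclideanSpace ℝ d}

omit [Fintype d] [DecidableEq d] in
/-- `∫ (X + Y) = ∫ X` when `Y` is integrable with `∫ Y = 0` (no integrability of `X` is needed). [folklore] -/
private theorem integral_add_eq_left_ti {α : Type*} [MeasurableSpace α] {μ : Measure α} {X Y : α → ℝ}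
    (hY : Integrable Y μ) (h0 : ∫ a, Y a ∂μ = 0) : ∫ a, (X a + Y a) ∂μ = ∫ a, X a ∂μ := by
  by_cases hX : Integrable X μ
  · rw [integral_add hX hY, h0, add_zero]
  · have hXY : ¬ Integrable (fun a => X a + Y a) μ := fun h => hX (by
      have h2 := h.sub hY
      rwa [show ((fun a => X a + Y a) - Y) = X from funext fun a => by simp [Pi.sub_apply]] at h2)
    rw [integral_undef hX, integral_undef hXY]

/-- For a.e. `t ∈ (0,T)` the slice `w t ∈ L²` pairs integrably with every continuous field.
[cite: DiPernaLions1989, §II.1 (12)–(14)] -/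
theorem ae_integrable_inner_of_continuous (h : IsWeakTensorPassiveVectorDistortedOn A T 𝔸 b G w₀ w) :
    ∀ᵐ t ∂(volume.restrict (Ioo 0 T)), ∀ V : UnitAddTorus d → EuclideanSpace ℝ d, Continuous V →
      Integrable (fun x => ⟪w t x, V x⟫_ℝ) volume := by
  filter_upwards [h.ae_memLp_two] with t ht V hV
  obtain ⟨M, hM⟩ := isCompact_univ.exists_bound_of_continuousOn hV.continuousOn
  have hw : Integrable (w t) volume := ht.integrable one_le_two
  refine Integrable.mono' (hw.norm.mul_const M) (ht.1.inner hV.aestronglyMeasurable) ?_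
  filter_upwards with x
  rw [Real.norm_eq_abs]
  exact (abs_real_inner_le_norm _ _).trans (mul_le_mul_of_nonneg_left (hM x (mem_univ x)) (norm_nonneg _))

/-- **T♮2 — TRANSVERSE-CLASS INVARIANCE OF THE DISTORTED WEAK CLASS FOR HOLONOMIC FRAMES (general
index type, explicit decomposition).**  Let `G(t,·)` (for `t ∈ (0,T)`) be smooth with divergence-free
columns (Piola) and HOLONOMIC, `G(t)·(1 + ∇φ_t) = 1` for a smooth periodic displacement `φ_t` (the
inverse Jacobian of a measure-preserving map `y ↦ y + φ_t(y)`; Armstrong–Vicol's Lagrangian coordinates),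
and let `𝔸' = 𝔸 + traceL A + traceR B + Z` with `Z` `(a,b)`-antisymmetric.  Then every distorted weak
solution for `𝔸` is one for `𝔸'` (same carrier, frame, coupling, datum): in the weak formulation the left
trace coupling dies pointwise by test-side Piola, the antisymmetric part by the torsion identity, and the
right trace coupling is `Gᵀ∇φ`, which pairs to zero against `w` because `∇·(Gw) = 0` weakly.
[cite: ArmstrongVicol2025, §4.1 (s_{m−1}, T_{m−1}), PDF p. 34] [cite: Giaquinta1983MultipleIntegrals, Ch. III §2 eq. (2.1)-(2.3)]
[cite: Evans2010, §8.1.4.b] -/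
theorem of_add_decomp (h : IsWeakTensorPassiveVectorDistortedOn A T 𝔸 b G w₀ w)
    (hGs : ∀ t ∈ Ioo 0 T, ∀ c a, FunctionSpaces.Torus.IsSmooth (fun y => G t y c a))
    (hGp : ∀ t ∈ Ioo 0 T, ∀ a, FunctionSpaces.Torus.IsDivFree (fun y => (WithLp.toLp 2 fun c => G t y c a : EuclideanSpace ℝ d)))
    (hGh : ∀ t ∈ Ioo 0 T, ∃ φ : UnitAddTorus d → EuclideanSpace ℝ d, FunctionSpaces.Torus.IsSmooth φ ∧
      ∀ y, G t y * Matrix.of (fun a c => (1 : Matrix d d ℝ) a c + FunctionSpaces.Torus.partialDeriv c (fun z => φ z a) y) = 1)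
    (Am Bm : Matrix d d ℝ) {Z : Visc4 d} (hZ : Visc4.IsDerivAntisymm Z)
    (h𝔸' : 𝔸' = 𝔸 + Visc4.traceL Am + Visc4.traceR Bm + Z) :
    IsWeakTensorPassiveVectorDistortedOn A T 𝔸' b G w₀ w where
  aestronglyMeasurable := h.aestronglyMeasurable
  aestronglyMeasurable_carrier := h.aestronglyMeasurable_carrier
  ae_lintegral_sq_le := h.ae_lintegral_sq_le
  lintegral_carrier_lt_top := h.lintegral_carrier_lt_top
  lintegral_mul_lt_top := h.lintegral_mul_lt_top
  ae_isWeaklyDivFree_carrier := h.ae_isWeaklyDivFree_carrier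
  ae_isWeaklyDivFree_distort := h.ae_isWeaklyDivFree_distort
  weak_eq Ψ hΨ hΨdiv := by
    have hw := h.weak_eq Ψ hΨ hΨdiv
    convert hw using 2
    refine integral_congr_ae ?_
    filter_upwards [h.ae_isWeaklyDivFree_distort, h.ae_integrable_inner_of_continuous,
      ae_restrict_mem measurableSet_Ioo] with t hdivw hint ht
    have hΨs := hΨ.isSmooth_slice t
    set V : UnitAddTorus d → EuclideanSpace ℝ d :=
      viscAdjVar (fun y => Visc4.conj (G t y) (Visc4.traceR Bm)) (Ψ t) with hVdef
    have hV : ∀ x, viscAdjVar (fun y => Visc4.conj (G t y) 𝔸') (Ψ t) x =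
        viscAdjVar (fun y => Visc4.conj (G t y) 𝔸) (Ψ t) x + V x := by
      intro x
      rw [h𝔸']
      exact viscAdjVar_conj_add_decomp (hGs t ht) (hGp t ht) (hGh t ht) hΨs (hΨdiv t) 𝔸 Am Bm hZ x
    have hI0 : ∫ x, ⟪w t x, V x⟫_ℝ = 0 :=
      integral_inner_viscAdjVar_conj_traceR_eq_zero (hGs t ht) (hGp t ht) hΨs Bm hdivw
    have hIV : Integrable (fun x => ⟪w t x, V x⟫_ℝ) volume :=
      hint V (continuous_viscAdjVar_conj_traceR (hGs t ht) (hGp t ht) hΨs Bm)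
    have e : (fun x => ⟪w t x, FunctionSpaces.Torus.timeDeriv Ψ t x + FunctionSpaces.Torus.convect (b t) (Ψ t) x +
          viscAdjVar (fun y => Visc4.conj (G t y) 𝔸') (Ψ t) x⟫_ℝ +
        A * ⟪b t x, FunctionSpaces.Torus.convect (w t) (Ψ t) x⟫_ℝ) =
        fun x => (⟪w t x, FunctionSpaces.Torus.timeDeriv Ψ t x + FunctionSpaces.Torus.convect (b t) (Ψ t) x +
          viscAdjVar (fun y => Visc4.conj (G t y) 𝔸) (Ψ t) x⟫_ℝ +
        A * ⟪b t x, FunctionSpaces.Torus.convect (w t) (Ψ t) x⟫_ℝ) + ⟪w t x, V x⟫_ℝ := by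
      funext x
      rw [hV x, ← add_assoc, inner_add_right]
      ring
    rw [e, integral_add_eq_left_ti hIV hI0]

/-- **T♮2 at `d = 3`: the distorted weak class of a HOLONOMIC frame depends on the tensor only through
its transverse class** (`TransverseEq 𝔸 𝔸'` ⇒ same solutions), by the classification T♮0
(`transverseEq_iff_exists_decomp`) and `of_add_decomp`.
[cite: ArmstrongVicol2025, §4.1 (s_{m−1}, T_{m−1}), PDF p. 34] [cite: Giaquinta1983MultipleIntegrals, Ch. III §2 eq. (2.1)-(2.3)]
[cite: Evans2010, §8.1.4.b] -/
theorem of_transverseEq {𝔸 𝔸' : Visc4 (Fin 3)} {b w : ℝ → UnitAddTorus (Fin 3) → EuclideanSpace ℝ (Fin 3)}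
    {G : ℝ → UnitAddTorus (Fin 3) → Matrix (Fin 3) (Fin 3) ℝ} {w₀ : UnitAddTorus (Fin 3) → EuclideanSpace ℝ (Fin 3)}
    (h : IsWeakTensorPassiveVectorDistortedOn A T 𝔸 b G w₀ w)
    (hGs : ∀ t ∈ Ioo 0 T, ∀ c a, FunctionSpaces.Torus.IsSmooth (fun y => G t y c a))
    (hGp : ∀ t ∈ Ioo 0 T, ∀ a,
      FunctionSpaces.Torus.IsDivFree (fun y => (WithLp.toLp 2 fun c => G t y c a : EuclideanSpace ℝ (Fin 3))))
    (hGh : ∀ t ∈ Ioo 0 T, ∃ φ : UnitAddTorus (Fin 3) → EuclideanSpace ℝ (Fin 3), FunctionSpaces.Torus.IsSmooth φ ∧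
      ∀ y, G t y * Matrix.of (fun a c => (1 : Matrix (Fin 3) (Fin 3) ℝ) a c +
        FunctionSpaces.Torus.partialDeriv c (fun z => φ z a) y) = 1)
    (h𝔸 : TransverseEq 𝔸 𝔸') : IsWeakTensorPassiveVectorDistortedOn A T 𝔸' b G w₀ w := by
  obtain ⟨Am, Bm, Z, hZ, h𝔸'⟩ := (transverseEq_iff_exists_decomp 𝔸 𝔸').1 h𝔸
  exact h.of_add_decomp hGs hGp hGh Am Bm hZ h𝔸'

/-- **T♮2 as an `Iff`** (`d = 3`, holonomic frame): transversely equivalent tensors have the same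
distorted weak solutions. [cite: ArmstrongVicol2025, §4.1 (s_{m−1}, T_{m−1}), PDF p. 34]
[cite: Giaquinta1983MultipleIntegrals, Ch. III §2 eq. (2.1)-(2.3)] -/
theorem _root_.Literature.Analysis.FluidPDE.Torus.TransverseEq.isWeakTensorPassiveVectorDistortedOn_iff
    {𝔸 𝔸' : Visc4 (Fin 3)} {b w : ℝ → UnitAddTorus (Fin 3) → EuclideanSpace ℝ (Fin 3)}
    {G : ℝ → UnitAddTorus (Fin 3) → Matrix (Fin 3) (Fin 3) ℝ} {w₀ : UnitAddTorus (Fin 3) → EuclideanSpace ℝ (Fin 3)}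
    (h𝔸 : TransverseEq 𝔸 𝔸')
    (hGs : ∀ t ∈ Ioo 0 T, ∀ c a, FunctionSpaces.Torus.IsSmooth (fun y => G t y c a))
    (hGp : ∀ t ∈ Ioo 0 T, ∀ a,
      FunctionSpaces.Torus.IsDivFree (fun y => (WithLp.toLp 2 fun c => G t y c a : EuclideanSpace ℝ (Fin 3))))
    (hGh : ∀ t ∈ Ioo 0 T, ∃ φ : UnitAddTorus (Fin 3) → EuclideanSpace ℝ (Fin 3), FunctionSpaces.Torus.IsSmooth φ ∧
      ∀ y, G t y * Matrix.of (fun a c => (1 : Matrix (Fin 3) (Fin 3) ℝ) a c +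
        FunctionSpaces.Torus.partialDeriv c (fun z => φ z a) y) = 1) :
    IsWeakTensorPassiveVectorDistortedOn A T 𝔸 b G w₀ w ↔ IsWeakTensorPassiveVectorDistortedOn A T 𝔸' b G w₀ w :=
  ⟨fun h => h.of_transverseEq hGs hGp hGh h𝔸, fun h => h.of_transverseEq hGs hGp hGh h𝔸.symm⟩

end IsWeakTensorPassiveVectorDistortedOn

end ClassInvariance

/-! ## §4 The flat case (`G ≡ 1`): the flat weak class only sees the transverse class -/

section Flat

variable {Ψs : UnitAddTorus d → EuclideanSpace ℝ d}

/-- The constant identity frame: smooth entries. [folklore] -/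
private theorem isSmooth_one_entry_ti (c a : d) :
    FunctionSpaces.Torus.IsSmooth (fun _ : UnitAddTorus d => (1 : Matrix d d ℝ) c a) := FunctionSpaces.Torus.isSmooth_const _

/-- The constant identity frame: divergence-free columns. [folklore] -/
private theorem isDivFree_one_col_ti (a : d) :
    FunctionSpaces.Torus.IsDivFree (fun _ : UnitAddTorus d => (WithLp.toLp 2 fun c => (1 : Matrix d d ℝ) c a : EuclideanSpace ℝ d)) := by
  intro y
  unfold FunctionSpaces.Torus.divergence
  simp only [partialDeriv_const_ti, Finset.sum_const_zero]

/-- The constant identity frame is holonomic (`φ = 0`). [folklore] -/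
private theorem holonomic_one_ti :
    ∃ φ : UnitAddTorus d → EuclideanSpace ℝ d, FunctionSpaces.Torus.IsSmooth φ ∧
      ∀ y : UnitAddTorus d, (1 : Matrix d d ℝ) *
        Matrix.of (fun a c => (1 : Matrix d d ℝ) a c + FunctionSpaces.Torus.partialDeriv c (fun z => φ z a) y) = 1 := by
  refine ⟨fun _ => 0, FunctionSpaces.Torus.isSmooth_const _, fun y => ?_⟩
  rw [Matrix.one_mul]
  ext a c
  rw [Matrix.of_apply, show (fun z : UnitAddTorus d => (0 : EuclideanSpace ℝ d) a) = fun _ => (0 : ℝ) from rfl,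
    partialDeriv_const_ti, add_zero]

/-- **The FLAT test operator only sees the transverse class (pointwise + one gradient).**  For a smooth
divergence-free test slice and `𝔸' = 𝔸 + traceL A + traceR B + Z` (`Z` `(a,b)`-antisymmetric):
`𝓛^*_{𝔸'} Ψ = 𝓛^*_𝔸 Ψ + ∇φ`, `φ = Σ_{ia} B_{ia} ∂_aΨ_i` — the case `G ≡ 1` of `viscAdjVar_conj_add_decomp`
(`viscAdjVar_conj_one`). [cite: Giaquinta1983MultipleIntegrals, Ch. III §2 eq. (2.1)-(2.3)] [cite: Evans2010, §8.1.4.b] -/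
theorem viscAdj_add_decomp (hΨ : FunctionSpaces.Torus.IsSmooth Ψs) (hdiv : FunctionSpaces.Torus.IsDivFree Ψs) (𝔸 : Visc4 d)
    (Am Bm : Matrix d d ℝ) {Z : Visc4 d} (hZ : Visc4.IsDerivAntisymm Z) (x : UnitAddTorus d) :
    viscAdj (𝔸 + Visc4.traceL Am + Visc4.traceR Bm + Z) Ψs x =
      viscAdj 𝔸 Ψs x + viscAdjVar (fun _ => Visc4.conj (1 : Matrix d d ℝ) (Visc4.traceR Bm)) Ψs x := by
  have hdiv' : FunctionSpaces.Torus.IsDivFree (distort (fun _ => (1 : Matrix d d ℝ)) Ψs) := by rwa [distort_one]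
  rw [← viscAdjVar_conj_one _ hΨ, ← viscAdjVar_conj_one 𝔸 hΨ]
  exact viscAdjVar_conj_add_decomp (Gs := fun _ => (1 : Matrix d d ℝ)) isSmooth_one_entry_ti
    isDivFree_one_col_ti holonomic_one_ti hΨ hdiv' 𝔸 Am Bm hZ x

namespace IsWeakTensorPassiveVectorOn

variable {A T : ℝ} {𝔸 𝔸' : Visc4 d} {b w : ℝ → UnitAddTorus d → EuclideanSpace ℝ d}
  {w₀ : UnitAddTorus d → EuclideanSpace ℝ d}

omit [Fintype d] [DecidableEq d] in
/-- `∫ (X + Y) = ∫ X` when `Y` is integrable with `∫ Y = 0`. [folklore] -/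
private theorem integral_add_eq_left_ti' {α : Type*} [MeasurableSpace α] {μ : Measure α} {X Y : α → ℝ}
    (hY : Integrable Y μ) (h0 : ∫ a, Y a ∂μ = 0) : ∫ a, (X a + Y a) ∂μ = ∫ a, X a ∂μ := by
  by_cases hX : Integrable X μ
  · rw [integral_add hX hY, h0, add_zero]
  · have hXY : ¬ Integrable (fun a => X a + Y a) μ := fun h => hX (by
      have h2 := h.sub hY
      rwa [show ((fun a => X a + Y a) - Y) = X from funext fun a => by simp [Pi.sub_apply]] at h2)
    rw [integral_undef hX, integral_undef hXY]

/-- **T♮2, FLAT CASE (general index type, explicit decomposition): the flat weak class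
`IsWeakTensorPassiveVectorOn` only sees the transverse class of the tensor** — transverse-equal
tensors pair equally against (divergence-free smooth test, weakly divergence-free `w`).
[cite: Giaquinta1983MultipleIntegrals, Ch. III §2 eq. (2.1)-(2.3)] [cite: Evans2010, §8.1.4.b]
[cite: Frisch1995Turbulence, §9.6.3 eq. (9.57) p. 233] -/
theorem of_add_decomp (h : IsWeakTensorPassiveVectorOn A T 𝔸 b w₀ w) (Am Bm : Matrix d d ℝ) {Z : Visc4 d}
    (hZ : Visc4.IsDerivAntisymm Z) (h𝔸' : 𝔸' = 𝔸 + Visc4.traceL Am + Visc4.traceR Bm + Z) :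
    IsWeakTensorPassiveVectorOn A T 𝔸' b w₀ w where
  aestronglyMeasurable := h.aestronglyMeasurable
  aestronglyMeasurable_carrier := h.aestronglyMeasurable_carrier
  ae_lintegral_sq_le := h.ae_lintegral_sq_le
  lintegral_carrier_lt_top := h.lintegral_carrier_lt_top
  lintegral_mul_lt_top := h.lintegral_mul_lt_top
  ae_isWeaklyDivFree_carrier := h.ae_isWeaklyDivFree_carrier
  ae_isWeaklyDivFree := h.ae_isWeaklyDivFree
  weak_eq Ψ hΨ hΨdiv := by
    have hw := h.weak_eq Ψ hΨ hΨdiv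
    convert hw using 2
    refine integral_congr_ae ?_
    filter_upwards [h.ae_isWeaklyDivFree, h.ae_memLp_two] with t hdivw hL2
    have hΨs : FunctionSpaces.Torus.IsSmooth (Ψ t) := hΨ.isSmooth_slice t
    have h1s : ∀ c a, FunctionSpaces.Torus.IsSmooth (fun _ : UnitAddTorus d => (1 : Matrix d d ℝ) c a) := isSmooth_one_entry_ti
    set V : UnitAddTorus d → EuclideanSpace ℝ d :=
      viscAdjVar (fun _ => Visc4.conj (1 : Matrix d d ℝ) (Visc4.traceR Bm)) (Ψ t) with hVdef
    have hV : ∀ x, viscAdj 𝔸' (Ψ t) x = viscAdj 𝔸 (Ψ t) x + V x := fun x => by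
      rw [h𝔸']; exact viscAdj_add_decomp hΨs (hΨdiv t) 𝔸 Am Bm hZ x
    have hVc : Continuous V := continuous_viscAdjVar_conj_traceR h1s isDivFree_one_col_ti hΨs Bm
    have hdivw' : FunctionSpaces.Torus.IsWeaklyDivFree (distort (fun _ => (1 : Matrix d d ℝ)) (w t)) := by rwa [distort_one]
    have hI0 : ∫ x, ⟪w t x, V x⟫_ℝ = 0 :=
      integral_inner_viscAdjVar_conj_traceR_eq_zero h1s isDivFree_one_col_ti hΨs Bm hdivw'
    have hIV : Integrable (fun x => ⟪w t x, V x⟫_ℝ) volume := by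
      obtain ⟨M, hM⟩ := isCompact_univ.exists_bound_of_continuousOn hVc.continuousOn
      have hwi : Integrable (w t) volume := hL2.integrable one_le_two
      refine Integrable.mono' (hwi.norm.mul_const M) (hL2.1.inner hVc.aestronglyMeasurable) ?_
      filter_upwards with x
      rw [Real.norm_eq_abs]
      exact (abs_real_inner_le_norm _ _).trans (mul_le_mul_of_nonneg_left (hM x (mem_univ x)) (norm_nonneg _))
    have e : (fun x => ⟪w t x, FunctionSpaces.Torus.timeDeriv Ψ t x + FunctionSpaces.Torus.convect (b t) (Ψ t) x + viscAdj 𝔸' (Ψ t) x⟫_ℝ +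
        A * ⟪b t x, FunctionSpaces.Torus.convect (w t) (Ψ t) x⟫_ℝ) =
        fun x => (⟪w t x, FunctionSpaces.Torus.timeDeriv Ψ t x + FunctionSpaces.Torus.convect (b t) (Ψ t) x + viscAdj 𝔸 (Ψ t) x⟫_ℝ +
        A * ⟪b t x, FunctionSpaces.Torus.convect (w t) (Ψ t) x⟫_ℝ) + ⟪w t x, V x⟫_ℝ := by
      funext x
      rw [hV x, ← add_assoc, inner_add_right]
      ring
    rw [e, integral_add_eq_left_ti' hIV hI0]

/-- **T♮2, flat case at `d = 3`**: transversely equivalent tensors have the same flat weak solutions.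
[cite: Giaquinta1983MultipleIntegrals, Ch. III §2 eq. (2.1)-(2.3)] [cite: Frisch1995Turbulence, §9.6.3 eq. (9.57) p. 233] -/
theorem of_transverseEq {𝔸 𝔸' : Visc4 (Fin 3)} {b w : ℝ → UnitAddTorus (Fin 3) → EuclideanSpace ℝ (Fin 3)}
    {w₀ : UnitAddTorus (Fin 3) → EuclideanSpace ℝ (Fin 3)}
    (h : IsWeakTensorPassiveVectorOn A T 𝔸 b w₀ w) (h𝔸 : TransverseEq 𝔸 𝔸') :
    IsWeakTensorPassiveVectorOn A T 𝔸' b w₀ w := by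
  obtain ⟨Am, Bm, Z, hZ, h𝔸'⟩ := (transverseEq_iff_exists_decomp 𝔸 𝔸').1 h𝔸
  exact h.of_add_decomp Am Bm hZ h𝔸'

/-- **T♮2, flat case, as an `Iff`** (`d = 3`). [cite: Giaquinta1983MultipleIntegrals, Ch. III §2 eq. (2.1)-(2.3)]
[cite: Frisch1995Turbulence, §9.6.3 eq. (9.57) p. 233] -/
theorem _root_.Literature.Analysis.FluidPDE.Torus.TransverseEq.isWeakTensorPassiveVectorOn_iff
    {𝔸 𝔸' : Visc4 (Fin 3)} {b w : ℝ → UnitAddTorus (Fin 3) → EuclideanSpace ℝ (Fin 3)}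
    {w₀ : UnitAddTorus (Fin 3) → EuclideanSpace ℝ (Fin 3)} (h𝔸 : TransverseEq 𝔸 𝔸') :
    IsWeakTensorPassiveVectorOn A T 𝔸 b w₀ w ↔ IsWeakTensorPassiveVectorOn A T 𝔸' b w₀ w :=
  ⟨fun h => h.of_transverseEq h𝔸, fun h => h.of_transverseEq h𝔸.symm⟩

end IsWeakTensorPassiveVectorOn

end Flat

end Literature.Analysis.FluidPDE.Torus
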